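import Literature.Computability.QuantumComplexity.RevUncompute
import Literature.Computability.QuantumComplexity.RevTableauUniform
import Literature.Computability.Complexity.OracleEmpty
import Literature.Computability.Complexity.StringEquality
import HarnessLib

/-!
# Garbage-free reversible computation: printing the block, forwards and backwards

Trunk `CryptoQuantFine`, sequel of `RevUncompute.lean` (the clean block
`RevClean.cleanOps = notsV ++ comp ++ outOps ++ reverse comp ++ notsV` around the tableau of
`RevTableau.lean`) and of `RevTableauUniform.lean` (generator programs `RevSim.inputG`,
`RevSim.stepG` printing the tableau gate by gate; `GStmt.render_out_mem_FP`). For the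
uniformity of circuit families containing a clean block one needs its description as a
polynomial-time function of the input length. Two obstacles are dealt with here once and for
all:

* **The tableau length is a derived quantity.** Inside a larger family the tableau runs on
  `N(n)` wires (data plus a constant suffix), a polynomial in the family index `n`, whereas the
  generators of `RevTableauUniform.lean` read the tableau length off the input variable `xn`.
  `GExpr.subst`/`GStmt.subst` substitute counter expressions for free variables of a generator
  program, with `GStmt.out_subst` (the stream of the substituted program is the stream in the
  substituted environment), `loopVars_subst`, `noReuse_subst`.
* **The uncomputation runs the tableau backwards**, but counter expressions are monotone, so no
  generator program can enumerate the gates in reverse order. Instead we generate the *reversed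
  token stream*: `RevClean.opGR`/`opsGR` emit the tokens of each gate word back to front (dump
  before ticks, literals reversed), `stepGR`/`inputGR` are the twins of `stepG`/`inputG` over
  them, so that the generated stream of the compute half is `comp.flatMap (reverse ∘ opToks)`,
  whose reversal is `(reverse comp).flatMap opToks` (core's `List.reverse_flatMap`). Reversal of a
  string is in `FP` (`reverse_mem_FP`, the `pour` loop of `StackArith.lean`), rendering after
  reversal is in `FP` (`render_reverse_out_mem_FP`: generate the reversed three-bit codes,
  reverse, decode and render with `Tok.render_decode_mem_FP`), and descriptions are assembled
  from such pieces by concatenation (`append_mem_FP`, from `fanoutFn_mem_FP` of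
`StringEquality.lean` and the flattening transducer `EmptySim.concatT` of `OracleEmpty.lean`).

Besides: the generators of the other gadgets of the block (`notsSegG` for runs of `NOT` gates,
`outG` for the read-out fan-out, `compG`/`compGR` for the two halves) with their stream
identities (`out_compG`, `out_compGR`, …) and loop-variable hygiene, over the variables `GV` of
`RevTableauUniform.lean` with input variable `uu` and the tableau length given by an arbitrary
expression `NE` in `uu`.

## References

* S. Arora, B. Barak, *Computational Complexity: A Modern Approach*, CUP 2009, §6.2 and proof
  of Thm. 6.15 (descriptions printed with counters), §1.3 (robustness of polynomial time).
* C. H. Bennett, *Logical reversibility of computation*, IBM J. Res. Develop. 17 (1973), §2.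
  (Not held; see `RevUncompute.lean`.)
* P. W. Shor, SIAM J. Comput. 26 (1997), §2 p. 7 (uniformity: "the design of the gate array be
  produced by a polynomial-time (classical) computation") and §3.
-/

/-! ### Substitution in generator programs -/

namespace Literature.Computability.QuantumComplexity

section GExpr
open Literature.Computability.Complexity (GExpr)
open Literature.Computability.Complexity.GExpr

variable {V : Type}

/-- The variables occurring in an expression. Refactor: twin of `GExpr.vars`
(`CookLevinReduction.lean`, not imported here to keep the closure small); both to be hoisted to
`GenPrograms.lean`. [folklore] -/
def _root_.Literature.Computability.Complexity.GExpr.fv : GExpr V → List V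
  | const _ => []
  | var x => [x]
  | add a b => a.fv ++ b.fv
  | mul a b => a.fv ++ b.fv

/-- Substituting expressions for variables. [folklore] -/
def _root_.Literature.Computability.Complexity.GExpr.subst (σ : V → GExpr V) : GExpr V → GExpr V
  | const c => const c
  | var x => σ x
  | add a b => add (a.subst σ) (b.subst σ)
  | mul a b => mul (a.subst σ) (b.subst σ)

/-- The value of a substituted expression is the value in the substituted environment.
[folklore] -/
theorem _root_.Literature.Computability.Complexity.GExpr.eval_subst (σ : V → GExpr V) (env : V → ℕ) :
    ∀ a : GExpr V, (a.subst σ).eval env = a.eval fun x => (σ x).eval env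
  | const c => rfl
  | var x => rfl
  | add a b => by simp only [subst, eval, eval_subst σ env a, eval_subst σ env b]
  | mul a b => by simp only [subst, eval, eval_subst σ env a, eval_subst σ env b]

/-- An expression does not depend on variables it does not mention. Refactor: twin of
`GExpr.eval_update_of_not_mem` (`CookLevinReduction.lean`); both to be hoisted to
`GenPrograms.lean`. [folklore] -/
theorem _root_.Literature.Computability.Complexity.GExpr.eval_update_of_not_mem_fv [DecidableEq V] (env : V → ℕ) (i : V) (k : ℕ) :
    ∀ a : GExpr V, i ∉ a.fv → a.eval (Function.update env i k) = a.eval env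
  | const c, _ => rfl
  | var x, h => by
    have : x ≠ i := fun e => h (by simp [fv, e])
    simp [eval, this]
  | add a b, h => by
    simp only [fv, List.mem_append, not_or] at h
    simp only [eval, eval_update_of_not_mem_fv env i k a h.1, eval_update_of_not_mem_fv env i k b h.2]
  | mul a b, h => by
    simp only [fv, List.mem_append, not_or] at h
    simp only [eval, eval_update_of_not_mem_fv env i k a h.1, eval_update_of_not_mem_fv env i k b h.2]

end GExpr

section GStmt
open Literature.Computability.Complexity (GStmt)
open Literature.Computability.Complexity.GStmt

variable {V Γ : Type}

/-- Substituting expressions for the free variables of a generator program (loop variables are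
kept). [folklore] -/
def _root_.Literature.Computability.Complexity.GStmt.subst (σ : V → Complexity.GExpr V) : GStmt V Γ → GStmt V Γ
  | emit ts => emit ts
  | seq a b => seq (a.subst σ) (b.subst σ)
  | loop i c body => loop i (c.subst σ) (body.subst σ)

/-- Substitution keeps the loop variables. [folklore] -/
@[simp] theorem _root_.Literature.Computability.Complexity.GStmt.loopVars_subst (σ : V → Complexity.GExpr V) : ∀ s : GStmt V Γ, (s.subst σ).loopVars = s.loopVars
  | emit _ => rfl
  | seq a b => by simp only [subst, loopVars, loopVars_subst σ a, loopVars_subst σ b]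
  | loop i c body => by simp only [subst, loopVars, loopVars_subst σ body]

/-- Substitution keeps non-reuse. [folklore] -/
@[simp] theorem _root_.Literature.Computability.Complexity.GStmt.noReuse_subst [DecidableEq V] (σ : V → Complexity.GExpr V) : ∀ s : GStmt V Γ, (s.subst σ).noReuse = s.noReuse
  | emit _ => rfl
  | seq a b => by simp only [subst, noReuse, noReuse_subst σ a, noReuse_subst σ b]
  | loop i c body => by simp only [subst, noReuse, noReuse_subst σ body, loopVars_subst]

/-- A substitution is *admissible* for `s` if it fixes the loop variables of `s` and substitutes,
for the other variables, expressions not mentioning loop variables of `s`. [folklore] -/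
def _root_.Literature.Computability.Complexity.GStmt.SubstOK (σ : V → Complexity.GExpr V) (s : GStmt V Γ) : Prop :=
  ∀ i ∈ s.loopVars, σ i = .var i ∧ ∀ x, x ≠ i → i ∉ (σ x).fv

/-- Admissibility descends to the parts of a sequence. [folklore] -/
theorem _root_.Literature.Computability.Complexity.GStmt.SubstOK.seq_left {σ : V → Complexity.GExpr V} {a b : GStmt V Γ} (h : SubstOK σ (seq a b)) : SubstOK σ a :=
  fun i hi => h i (by simp [loopVars, hi])
/-- Admissibility descends to the parts of a sequence. [folklore] -/
theorem _root_.Literature.Computability.Complexity.GStmt.SubstOK.seq_right {σ : V → Complexity.GExpr V} {a b : GStmt V Γ} (h : SubstOK σ (seq a b)) : SubstOK σ b :=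
  fun i hi => h i (by simp [loopVars, hi])
/-- Admissibility descends to the body of a loop. [folklore] -/
theorem _root_.Literature.Computability.Complexity.GStmt.SubstOK.body {σ : V → Complexity.GExpr V} {i : V} {c : Complexity.GExpr V} {body : GStmt V Γ}
    (h : SubstOK σ (loop i c body)) : SubstOK σ body :=
  fun i hi => h i (by simp [loopVars, hi])

/-- **The stream of a substituted program is the stream in the substituted environment.**
[folklore] -/
theorem _root_.Literature.Computability.Complexity.GStmt.out_subst [DecidableEq V] (σ : V → Complexity.GExpr V) :
    ∀ (s : GStmt V Γ) (_ : SubstOK σ s) (env : V → ℕ),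
      (s.subst σ).out env = s.out fun x => (σ x).eval env
  | emit ts, _, env => rfl
  | seq a b, h, env => by
    simp only [subst, out, out_subst σ a h.seq_left env, out_subst σ b h.seq_right env]
  | loop i c body, h, env => by
    simp only [subst, out, Complexity.GExpr.eval_subst]
    congr 1
    funext k
    rw [out_subst σ body h.body]
    congr 1
    funext x
    obtain ⟨hi, hfv⟩ := h i (by simp [loopVars])
    by_cases hx : x = i
    · subst hx; simp [hi, Complexity.GExpr.eval]
    · rw [Function.update_of_ne hx, Complexity.GExpr.eval_update_of_not_mem_fv env i k (σ x) (hfv x hx)]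

end GStmt

end Literature.Computability.QuantumComplexity

/-! ### Strings: reversal and concatenation in `FP` -/

namespace Literature.Computability.QuantumComplexity

open _root_.Computability Complexity Turing RevDesc RevSim
open Complexity.SProg (dbl)

/-- **String reversal is polynomial time** (one pass pouring the input register onto the output
register, `Com.pour`). [Arora–Barak 2009, §1.3] [folklore] -/
theorem reverse_mem_FP : (List.reverse : List Bool → List Bool) ∈ FP := by
  refine Com.mem_FP (ι := Bool) (Com.pour true false) true false (3 * Polynomial.X + 1) _ fun z => ?_
  refine ⟨Function.update (Function.update (Regs.init true z) true []) false
    ((Regs.init true z true).reverse ++ Regs.init true z false), Or.inl ?_, ?_⟩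
  · refine (Com.runs_pour (ι := Bool) (a := true) (b := false) (by decide) (Regs.init true z)).mono ?_
    simp [Regs.init]
  · simp [Regs.init]

/-- **Concatenation of two `FP` functions is in `FP`** (`z ↦ f z ++ g z`, by pairing and
flattening). Refactor: twin of `Literature.Computability.Complexity.append_mem_FP` (`FPStringBricks.lean`), re-proved
here (from `fanoutFn_mem_FP` and the flattening transducer `EmptySim.concatT`) to keep the import
closure small (precedent: `SearchToDecision.lean`). [Arora–Barak 2009, §1.3] [folklore] -/
theorem append_mem_FP {f g : List Bool → List Bool} (hf : f ∈ FP) (hg : g ∈ FP) :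
    (fun z => f z ++ g z) ∈ FP := by
  have h := comp_mem_FP (EmptySim.concatT.polyTimeComputable_eval) (fanoutFn_mem_FP hf hg)
  have e : EmptySim.concatT.eval ∘ fanoutFn f g = fun z => f z ++ g z := by
    funext z; simp [EmptySim.concatT_eval]
  rwa [e] at h

/-- **Rendering the reversed stream of a generator program is polynomial time.** For a generator
`s` over tokens, `z ↦ render 0 (reverse (out s (x₀ ↦ |z|)))` is in `FP`: generate the stream
coded by the *reversed* three-bit codes (`GStmt.out_mem_FP` with any code), reverse the string
(`reverse_mem_FP`), decode and render (`Tok.render_decode_mem_FP`). [Arora–Barak 2009, §6.2 and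
proof of Thm. 6.15; §1.3] [folklore] -/
theorem render_reverse_out_mem_FP {V : Type} [DecidableEq V] [Fintype V] (s : GStmt V Tok) (x₀ : V)
    (hx : x₀ ∉ s.loopVars) (hs : s.noReuse = true) :
    (fun z => Tok.render 0 (s.out (GenProg.initEnv x₀ z.length)).reverse) ∈ FP := by
  have h1 := s.out_mem_FP (fun t => (Tok.code t).reverse) x₀ hx hs
  have h2 := comp_mem_FP reverse_mem_FP h1
  have h3 := comp_mem_FP Tok.render_decode_mem_FP h2
  have e : ((fun z => Tok.render 0 (Tok.decode z)) ∘ List.reverse ∘ fun z : List Bool =>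
      (s.out (GenProg.initEnv x₀ z.length)).flatMap fun t => (Tok.code t).reverse) =
      fun z => Tok.render 0 (s.out (GenProg.initEnv x₀ z.length)).reverse := by
    funext z
    simp only [Function.comp_apply, List.reverse_flatMap, Function.comp_def, List.reverse_reverse]
    rw [Tok.decode_code]
  rw [e] at h3
  exact h3

/-! ### Gate words with their tokens back to front -/

namespace RevClean

attribute [local instance] Turing.FinTM2.kFin Turing.FinTM2.ΛFin Turing.FinTM2.σFin
  Turing.FinTM2.Γk₀Fin

attribute [local simp] GExpr.eval

/-- Literal tokens of a reversed word. [folklore] -/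
theorem litT_reverse (bs : List Bool) : litT bs.reverse = (litT bs).reverse := by
  simp [litT, List.map_reverse]

/-- One wire index, tokens back to front: separator reversed, dump, ticks. [folklore] -/
def wireGR (w : GE) : GS :=
  .seq (.emit (litT [true, true, false, false] ++ [Tok.dump true true])) (ticksG w)

/-- The stream of `wireGR` is the reversed stream of `wireG`. [folklore] -/
@[simp] theorem out_wireGR (w : GE) (env : GV → ℕ) :
    (wireGR w).out env = (wireToks (w.eval env)).reverse := by
  simp [wireGR, GStmt.out, wireToks, litT, List.reverse_append]

/-- One abstract gate, tokens back to front. [folklore] -/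
def agateGR (g : AGate GE) : GS :=
  .seq (.emit (litT [true, false]))
    (.seq (seqs (g.wires.reverse.map wireGR))
      (.emit (litT (gatePre (symCode g.sym) (symArity g.sym)).reverse)))

/-- The stream of `agateGR` is the reversed stream of `agateG`. [folklore] -/
@[simp] theorem out_agateGR (g : AGate GE) (env : GV → ℕ) :
    (agateGR g).out env = ((g.map (GExpr.eval env)).toks).reverse := by
  simp only [agateGR, GStmt.out, out_seqs, List.flatMap_map, AGate.toks, AGate.map, gateToks,
    List.reverse_append, List.flatMap_reverse, out_wireGR]
  simp [litT, List.map_reverse, Function.comp_def]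

/-- One reversible gate, the tokens of its Clifford+T word back to front. [folklore] -/
def opGR (op : ClOp GE) : GS := seqs ((agates op).reverse.map agateGR)

/-- The stream of `opGR` is the reversed stream of `opG`. [folklore] -/
@[simp] theorem out_opGR (op : ClOp GE) (env : GV → ℕ) :
    (opGR op).out env = (opToks (op.map (GExpr.eval env))).reverse := by
  simp only [opGR, out_seqs, opToks, agates_map, List.map_reverse, List.flatMap_map, List.flatMap_reverse]
  simp

/-- A list of reversible gates in order, each word back to front. [folklore] -/
def opsGR (ops : List (ClOp GE)) : GS := seqs (ops.map opGR)

/-- The stream of `opsGR`: the gates in order, each token word reversed. [folklore] -/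
@[simp] theorem out_opsGR (ops : List (ClOp GE)) (env : GV → ℕ) :
    (opsGR ops).out env = (ops.map (ClOp.map (GExpr.eval env))).flatMap fun op => (opToks op).reverse := by
  simp [opsGR, List.flatMap_map]

/-- The loop variables of `opsGR` are tick counters. [folklore] -/
theorem loopVars_opsGR_sub (ops : List (ClOp GE)) : ∀ x ∈ (opsGR ops).loopVars, x = GV.ii := by
  intro x hx
  simp only [opsGR, loopVars_seqs, List.flatMap_map, List.mem_flatMap, opGR, agateGR, GStmt.loopVars,
    List.nil_append, List.append_nil, wireGR, ticksG, List.mem_reverse] at hx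
  obtain ⟨_, _, _, _, _, _, hx⟩ := hx
  simpa using hx

/-- `opsGR` does not reuse loop variables. [folklore] -/
theorem noReuse_opsGR (ops : List (ClOp GE)) : (opsGR ops).noReuse = true := by
  refine noReuse_seqs _ fun s hs => ?_
  simp only [List.mem_map] at hs
  obtain ⟨op, _, rfl⟩ := hs
  refine noReuse_seqs _ fun s hs => ?_
  simp only [List.mem_map] at hs
  obtain ⟨g, _, rfl⟩ := hs
  simp only [agateGR, GStmt.noReuse, Bool.true_and, Bool.and_true]
  refine noReuse_seqs _ fun s hs => ?_
  simp only [List.mem_map] at hs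
  obtain ⟨w, _, rfl⟩ := hs
  rfl

/-- `LV` for `opsGR`: only the tick counter. [folklore] -/
theorem lv_opsGR {P : GV → Prop} (hP : P .ii) (ops : List (ClOp GE)) : LV P (opsGR ops) := fun x hx =>
  (loopVars_opsGR_sub ops x hx) ▸ hP

/-! ### The tableau generators over an arbitrary gate printer -/

section Parametric

variable (tm : FinTM2) (e : ℕ)

/-- The step generator of `RevTableauUniform.lean` over an arbitrary printer `og` of gate
lists (`og = opsG`: `RevSim.stepG`; `og = opsGR`: tokens of every word back to front).
[folklore] -/
noncomputable def stepGW (og : List (ClOp GE) → GS) : GS :=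
  .seq (seqs ((vList tm).map fun v => og (chainOpsE tm e (.var .tt) v)))
  (.seq (seqs ((vList tm).map fun v => og (ctrlOpsE tm e (.var .tt) v)))
  (.seq (seqs ((List.range (2 * dd tm)).map fun j => seqs ((kaList tm).map fun ka =>
    seqs ((vList tm).map fun v => og (cellOpLowE tm e (.var .tt) j ka v)))))
  (.seq (.loop .jj (.add (.var .xn) (.mul (.const (dd tm)) (TnE e)))
    (seqs ((kaList tm).map fun ka => seqs ((vList tm).map fun v =>
      og (cellOpHighE tm e (.var .tt) (.var .jj) ka v)))))
  (.loop .jj (.const (dd tm)) (og (phantomE tm e (.var .tt) (.add (SnE tm e) (.var .jj))))))))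

/-- `stepGW opsG` is the step generator of the tableau family. [folklore] -/
theorem stepGW_opsG : stepGW tm e opsG = stepG tm e := rfl

variable {tm e}

/-- **The parametric step generator prints the step through the printer.** [folklore] -/
theorem out_stepGW (φ : ClOp ℕ → List Tok) (og : List (ClOp GE) → GS)
    (hog : ∀ ops env, (og ops).out env = (ops.map (ClOp.map (GExpr.eval env))).flatMap φ)
    (env : GV → ℕ) :
    (stepGW tm e og).out env = (stepOps tm e (env .xn) (env .tt)).flatMap φ := by
  have hxj : ∀ j, Function.update env GV.jj j GV.xn = env .xn := fun j => by simp
  have htj : ∀ j, Function.update env GV.jj j GV.tt = env .tt := fun j => by simp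
  simp only [stepGW, GStmt.out, out_seqs, List.flatMap_map, hog, chainOpsE_eval, ctrlOpsE_eval,
    cellOpLowE_eval, cellOpHighE_eval, phantomE_eval, GExpr.eval, hxj, htj, Function.update_self,
    eval_TnE, eval_SnE, stepOps, restOps, cellOps, List.flatMap_append, List.flatMap_assoc]
  rw [Sn_eq, flatMap_range_add (2 * dd tm), flatMap_range']
  simp only [List.append_assoc]

/-- Loop variables of the parametric step generator. [folklore] -/
theorem lv_stepGW {P : GV → Prop} {og : List (ClOp GE) → GS} (hog : ∀ ops, LV P (og ops))
    (hj : P .jj) : LV P (stepGW tm e og) :=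
  lv_seq (lv_seqs_map fun _ => hog _) (lv_seq (lv_seqs_map fun _ => hog _)
    (lv_seq (lv_seqs_map fun _ => lv_seqs_map fun _ => lv_seqs_map fun _ => hog _)
    (lv_seq (lv_loop hj (lv_seqs_map fun _ => lv_seqs_map fun _ => hog _)) (lv_loop hj (hog _)))))

/-- Non-reuse of the parametric step generator. [folklore] -/
theorem noReuse_stepGW {og : List (ClOp GE) → GS} (hlv : ∀ ops, LV (· ≠ GV.jj) (og ops))
    (hnr : ∀ ops, (og ops).noReuse = true) : (stepGW tm e og).noReuse = true :=
  noReuse_seq_of (noReuse_seqs_map fun _ => hnr _) (noReuse_seq_of (noReuse_seqs_map fun _ => hnr _)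
    (noReuse_seq_of (noReuse_seqs_map fun _ => noReuse_seqs_map fun _ => noReuse_seqs_map fun _ => hnr _)
    (noReuse_seq_of (noReuse_loop_of (lv_seqs_map fun _ => lv_seqs_map fun _ => hlv _)
      (noReuse_seqs_map fun _ => noReuse_seqs_map fun _ => hnr _))
      (noReuse_loop_of (hlv _) (hnr _)))))

variable (e) (M : TM2ComputableAux Bool Bool)

/-- The input-layer generator over an arbitrary printer. [folklore] -/
noncomputable def inputGW (og : List (ClOp GE) → GS) : GS :=
  .seq (og [ClOp.not (ctrlWE M.tm e (.const 0) (some M.tm.main, M.tm.initialState))])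
  (.seq (.loop .jj (.var .xn) (og (inCellE e M (.var .jj))))
  (.loop .jj (.add (.mul (.const (dd M.tm)) (TnE e)) (.const (3 * dd M.tm)))
    (og (emptyCellE M.tm e (.add (.var .xn) (.var .jj))))))

/-- `inputGW opsG` is the input generator of the tableau family. [folklore] -/
theorem inputGW_opsG : inputGW e M opsG = inputG e M := rfl

variable {e M}

/-- **The parametric input generator prints the input layer through the printer.** [folklore] -/
theorem out_inputGW (φ : ClOp ℕ → List Tok) (og : List (ClOp GE) → GS)
    (hog : ∀ ops env, (og ops).out env = (ops.map (ClOp.map (GExpr.eval env))).flatMap φ)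
    (env : GV → ℕ) :
    (inputGW e M og).out env = (inputOps e M (env .xn)).flatMap φ := by
  have hxj : ∀ j, Function.update env GV.jj j GV.xn = env .xn := fun j => by simp
  simp only [inputGW, GStmt.out, hog, inCellE_eval, emptyCellE_eval, GExpr.eval, hxj,
    Function.update_self, eval_TnE, inputOps, List.flatMap_append, List.map_cons, List.map_nil, ClOp.map,
    eval_ctrlWE, List.flatMap_assoc]
  rw [flatMap_range', Sn_add_sub]

/-- Loop variables of the parametric input generator. [folklore] -/
theorem lv_inputGW {P : GV → Prop} {og : List (ClOp GE) → GS} (hog : ∀ ops, LV P (og ops))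
    (hj : P .jj) : LV P (inputGW e M og) :=
  lv_seq (hog _) (lv_seq (lv_loop hj (hog _)) (lv_loop hj (hog _)))

/-- Non-reuse of the parametric input generator. [folklore] -/
theorem noReuse_inputGW {og : List (ClOp GE) → GS} (hlv : ∀ ops, LV (· ≠ GV.jj) (og ops))
    (hnr : ∀ ops, (og ops).noReuse = true) : (inputGW e M og).noReuse = true :=
  noReuse_seq_of (hnr _) (noReuse_seq_of (noReuse_loop_of (hlv _) (hnr _)) (noReuse_loop_of (hlv _) (hnr _)))

end Parametric

/-! ### Substituting the tableau length -/

/-- The substitution of the expression `NE` for the tableau-length variable `xn`. [folklore] -/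
def substN (NE : GE) : GV → GE
  | .xn => NE
  | x => .var x

/-- `substN` on `xn`. [folklore] -/
@[simp] theorem substN_xn (NE : GE) : substN NE .xn = NE := rfl
/-- `substN` elsewhere. [folklore] -/
theorem substN_of_ne (NE : GE) {x : GV} (hx : x ≠ .xn) : substN NE x = .var x := by
  cases x <;> first | rfl | exact absurd rfl hx

/-- The substituted environment: `xn ↦ NE`, the other variables kept. [folklore] -/
theorem eval_substN (NE : GE) (env : GV → ℕ) :
    (fun x => (substN NE x).eval env) = Function.update env .xn (NE.eval env) := by
  funext x
  cases x <;> simp [substN]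

/-- An expression in `uu` only (the family index) is admissible: it mentions no loop variable.
[folklore] -/
def InUU (NE : GE) : Prop := ∀ x ∈ NE.fv, x = GV.uu

/-- Admissibility of `substN NE` for a program whose loop variables are among `tt, jj, ii`.
[folklore] -/
theorem substOK_substN {NE : GE} (hNE : InUU NE) {s : GS}
    (hs : ∀ i ∈ s.loopVars, i = GV.tt ∨ i = GV.jj ∨ i = GV.ii) : GStmt.SubstOK (substN NE) s := by
  intro i hi
  have hi' := hs i hi
  have hne : i ≠ .xn := by rcases hi' with rfl | rfl | rfl <;> decide
  refine ⟨substN_of_ne NE hne, fun x hx hmem => ?_⟩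
  by_cases hxn : x = .xn
  · subst hxn
    rw [substN_xn] at hmem
    have := hNE i hmem
    rcases hi' with rfl | rfl | rfl <;> exact absurd this (by decide)
  · rw [substN_of_ne NE hxn] at hmem
    simp only [GExpr.fv, List.mem_singleton] at hmem
    exact hx hmem.symm

section Blocks

variable (e : ℕ) (M : TM2ComputableAux Bool Bool)

/-- **The generator of the compute half** on tableau length `NE` (an expression in the family
index `uu`), through the printer `og`. [folklore] -/
noncomputable def compGW (og : List (ClOp GE) → GS) (NE : GE) : GS :=
  (GStmt.seq (inputGW e M og) (.loop .tt (TnE e) (stepGW M.tm e og))).subst (substN NE)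

/-- The result wire of cell `jE` and code `a`, as an expression (tableau length `xn`).
[folklore] -/
noncomputable def resWE (jE : GE) (a : OSym M) : GE :=
  .add (.add (.var .xn) (ancNE M.tm e)) (.add (.mul jE (.const (A₁ M))) (.const (eA M a)))

/-- The number of cells read out, as an expression. [folklore] -/
noncomputable def JJE : GE := .add (SnE M.tm e) (.const (dd M.tm))

/-- **The generator of the read-out** on tableau length `NE`, through the printer `og`.
[folklore] -/
noncomputable def outGW (og : List (ClOp GE) → GS) (NE : GE) : GS :=
  (GStmt.loop .jj (JJE e M) (seqs ((aList M).map fun a =>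
    og [ClOp.cnot (cellWE M.tm e (TnE e) (.var .jj) ⟨M.tm.k₁, a⟩) (resWE e M (.var .jj) a)]))).subst (substN NE)

/-- **The generator of runs of `NOT` gates**: for every segment `(s, m)` the gates
`NOT (s + i)`, `i < m`. [folklore] -/
def notsSegG (segs : List (GE × GE)) : GS :=
  seqs (segs.map fun p => .loop .jj p.2 (opsG [ClOp.not (.add p.1 (.var .jj))]))

variable {e M}

/-- value of `resWE` [folklore] -/
@[simp] theorem eval_resWE (jE : GE) (a : OSym M) (env : GV → ℕ) :
    (resWE e M jE a).eval env = resW e M (env .xn) (jE.eval env) a := by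
  simp [resWE, resW, RevSim.NN]

/-- value of `JJE` [folklore] -/
@[simp] theorem eval_JJE (env : GV → ℕ) : (JJE e M).eval env = JJ e M (env .xn) := by
  simp [JJE, JJ]

/-- Loop variables of the unsubstituted compute generator. [folklore] -/
theorem loopVars_comp_sub {og : List (ClOp GE) → GS} (hog : ∀ ops, ∀ x ∈ (og ops).loopVars, x = GV.ii) :
    ∀ i ∈ (GStmt.seq (inputGW e M og) (.loop .tt (TnE e) (stepGW M.tm e og))).loopVars,
      i = GV.tt ∨ i = GV.jj ∨ i = GV.ii := by
  have h1 : LV (fun i => i = GV.tt ∨ i = GV.jj ∨ i = GV.ii) (inputGW e M og) :=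
    lv_inputGW (fun ops x hx => Or.inr (Or.inr (hog ops x hx))) (Or.inr (Or.inl rfl))
  have h2 : LV (fun i => i = GV.tt ∨ i = GV.jj ∨ i = GV.ii) (stepGW M.tm e og) :=
    lv_stepGW (fun ops x hx => Or.inr (Or.inr (hog ops x hx))) (Or.inr (Or.inl rfl))
  exact lv_seq h1 (lv_loop (Or.inl rfl) h2)

/-- **The compute generator prints the compute half through the printer**, on tableau length
`NE.eval env`. [folklore] -/
theorem out_compGW (φ : ClOp ℕ → List Tok) {og : List (ClOp GE) → GS}
    (hog : ∀ ops env, (og ops).out env = (ops.map (ClOp.map (GExpr.eval env))).flatMap φ)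
    (hlv : ∀ ops, ∀ x ∈ (og ops).loopVars, x = GV.ii) {NE : GE} (hNE : InUU NE) (env : GV → ℕ) :
    (compGW e M og NE).out env = (comp e M (NE.eval env)).flatMap φ := by
  rw [compGW, GStmt.out_subst _ _ (substOK_substN hNE (loopVars_comp_sub hlv)), eval_substN]
  have hxt : ∀ t, Function.update (Function.update env GV.xn (NE.eval env)) GV.tt t GV.xn = NE.eval env :=
    fun t => by simp
  simp only [GStmt.out, out_inputGW φ og hog, out_stepGW φ og hog, Function.update_self, eval_TnE, hxt,
    comp, List.flatMap_append, List.flatMap_assoc]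

/-- **The forward compute generator prints `comp.flatMap opToks`.** [folklore] -/
theorem out_compG {NE : GE} (hNE : InUU NE) (env : GV → ℕ) :
    (compGW e M opsG NE).out env = (comp e M (NE.eval env)).flatMap opToks :=
  out_compGW opToks out_opsG loopVars_opsG_sub hNE env

/-- **The backward compute generator prints `comp.flatMap (reverse ∘ opToks)`**, whose reversal is
the token stream of `reverse comp`. [folklore] -/
theorem out_compGR {NE : GE} (hNE : InUU NE) (env : GV → ℕ) :
    (compGW e M opsGR NE).out env = (comp e M (NE.eval env)).flatMap fun op => (opToks op).reverse :=
  out_compGW _ out_opsGR loopVars_opsGR_sub hNE env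

/-- The reversal of the backward stream is the stream of the reversed compute half. [folklore] -/
theorem reverse_out_compGR {NE : GE} (hNE : InUU NE) (env : GV → ℕ) :
    ((compGW e M opsGR NE).out env).reverse = (comp e M (NE.eval env)).reverse.flatMap opToks := by
  rw [out_compGR hNE, List.reverse_flatMap]
  simp only [Function.comp_def, List.reverse_reverse]

/-- Loop variables of the compute generators. [folklore] -/
theorem loopVars_compGW_sub {og : List (ClOp GE) → GS} (hog : ∀ ops, ∀ x ∈ (og ops).loopVars, x = GV.ii)
    (NE : GE) : ∀ i ∈ (compGW e M og NE).loopVars, i = GV.tt ∨ i = GV.jj ∨ i = GV.ii := by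
  rw [compGW, GStmt.loopVars_subst]
  exact loopVars_comp_sub hog

/-- Non-reuse of the compute generators. [folklore] -/
theorem noReuse_compGW {og : List (ClOp GE) → GS} (hog : ∀ ops, ∀ x ∈ (og ops).loopVars, x = GV.ii)
    (hnr : ∀ ops, (og ops).noReuse = true) (NE : GE) : (compGW e M og NE).noReuse = true := by
  rw [compGW, GStmt.noReuse_subst]
  have hlvj : ∀ ops, LV (· ≠ GV.jj) (og ops) := fun ops x hx => by rw [hog ops x hx]; decide
  have hlvt : ∀ ops, LV (· ≠ GV.tt) (og ops) := fun ops x hx => by rw [hog ops x hx]; decide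
  exact noReuse_seq_of (noReuse_inputGW hlvj hnr)
    (noReuse_loop_of (lv_stepGW hlvt (by decide)) (noReuse_stepGW hlvj hnr))

/-- **The read-out generator prints the read-out through the printer.** [folklore] -/
theorem out_outGW (φ : ClOp ℕ → List Tok) {og : List (ClOp GE) → GS}
    (hog : ∀ ops env, (og ops).out env = (ops.map (ClOp.map (GExpr.eval env))).flatMap φ)
    (hlv : ∀ ops, ∀ x ∈ (og ops).loopVars, x = GV.ii) {NE : GE} (hNE : InUU NE) (env : GV → ℕ) :
    (outGW e M og NE).out env = (outOps e M (NE.eval env)).flatMap φ := by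
  have hok : GStmt.SubstOK (substN NE) (GStmt.loop .jj (JJE e M) (seqs ((aList M).map fun a =>
      og [ClOp.cnot (cellWE M.tm e (TnE e) (.var .jj) ⟨M.tm.k₁, a⟩) (resWE e M (.var .jj) a)]))) := by
    refine substOK_substN hNE fun i hi => ?_
    simp only [GStmt.loopVars, List.mem_cons, loopVars_seqs, List.mem_flatMap, List.mem_map] at hi
    rcases hi with rfl | ⟨s, ⟨a, -, rfl⟩, hx⟩
    · exact Or.inr (Or.inl rfl)
    · exact Or.inr (Or.inr (hlv _ i hx))
  rw [outGW, GStmt.out_subst _ _ hok, eval_substN]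
  have hxj : ∀ j, Function.update (Function.update env GV.xn (NE.eval env)) GV.jj j GV.xn = NE.eval env :=
    fun j => by simp
  simp only [GStmt.out, out_seqs, List.flatMap_map, hog, Function.update_self, eval_JJE, hxj, outOps,
    copyOps, outPairs, List.map_flatMap, List.map_map, List.flatMap_assoc, List.map_cons, List.map_nil,
    ClOp.map, eval_cellWE, eval_TnE, eval_resWE, GExpr.eval, List.flatMap_cons, List.flatMap_nil,
    List.append_nil, Function.comp_apply, List.flatMap_map]

/-- Loop variables of the read-out generator. [folklore] -/
theorem loopVars_outGW_sub {og : List (ClOp GE) → GS} (hog : ∀ ops, ∀ x ∈ (og ops).loopVars, x = GV.ii)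
    (NE : GE) : ∀ i ∈ (outGW e M og NE).loopVars, i = GV.tt ∨ i = GV.jj ∨ i = GV.ii := by
  rw [outGW, GStmt.loopVars_subst]
  intro i hi
  simp only [GStmt.loopVars, List.mem_cons, loopVars_seqs, List.mem_flatMap, List.mem_map] at hi
  rcases hi with rfl | ⟨s, ⟨a, -, rfl⟩, hx⟩
  · exact Or.inr (Or.inl rfl)
  · exact Or.inr (Or.inr (hog _ i hx))

/-- Non-reuse of the read-out generator. [folklore] -/
theorem noReuse_outGW {og : List (ClOp GE) → GS} (hog : ∀ ops, ∀ x ∈ (og ops).loopVars, x = GV.ii)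
    (hnr : ∀ ops, (og ops).noReuse = true) (NE : GE) : (outGW e M og NE).noReuse = true := by
  rw [outGW, GStmt.noReuse_subst]
  refine noReuse_loop_of (lv_seqs_map fun a x hx => ?_) (noReuse_seqs_map fun a => hnr _)
  rw [hog _ x hx]; decide

/-- **The `NOT`-run generator prints the runs** (segment starts must not mention the cell
counter `jj`). [folklore] -/
theorem out_notsSegG (segs : List (GE × GE)) (hfv : ∀ p ∈ segs, GV.jj ∉ p.1.fv) (env : GV → ℕ) :
    (notsSegG segs).out env =
      (segs.flatMap fun p => (List.range (p.2.eval env)).map fun i => ClOp.not (p.1.eval env + i)).flatMap opToks := by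
  induction segs with
  | nil => rfl
  | cons p segs ih =>
    have hp := hfv p (by simp)
    rw [notsSegG, List.map_cons, seqs, GStmt.out, ← notsSegG, ih (fun q hq => hfv q (by simp [hq])),
      List.flatMap_cons, List.flatMap_append]
    congr 1
    simp only [GStmt.out, out_opsG, List.map_cons, List.map_nil, ClOp.map, GExpr.eval,
      Function.update_self, GExpr.eval_update_of_not_mem_fv env GV.jj _ p.1 hp, List.flatMap_map]
    simp

/-- Loop variables of the `NOT`-run generator. [folklore] -/
theorem loopVars_notsSegG_sub (segs : List (GE × GE)) :
    ∀ i ∈ (notsSegG segs).loopVars, i = GV.tt ∨ i = GV.jj ∨ i = GV.ii := by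
  intro i hi
  simp only [notsSegG, loopVars_seqs, List.flatMap_map, List.mem_flatMap, GStmt.loopVars, List.mem_cons] at hi
  obtain ⟨p, -, rfl | hx⟩ := hi
  · exact Or.inr (Or.inl rfl)
  · exact Or.inr (Or.inr (loopVars_opsG_sub _ i hx))

/-- Non-reuse of the `NOT`-run generator. [folklore] -/
theorem noReuse_notsSegG (segs : List (GE × GE)) : (notsSegG segs).noReuse = true :=
  noReuse_seqs_map fun p => noReuse_loop_of (lv_opsG (by decide) _) (noReuse_opsG _)

end Blocks

/-! ### Runs of `NOT` gates and the suffix gadget -/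

/-- The suffix gadget of a concatenation. [folklore] -/
theorem notsV_append (n₀ : ℕ) (v v' : List Bool) :
    notsV n₀ (v ++ v') = notsV n₀ v ++ notsV (n₀ + v.length) v' := by
  simp only [notsV, List.length_append, List.range_add, List.filter_append, List.map_append]
  congr 1
  · congr 1
    refine List.filter_congr fun i hi => ?_
    rw [List.mem_range] at hi
    rw [List.getD_append _ _ _ _ hi]
  · rw [List.filter_map, List.map_map]
    have : (fun i => (v ++ v').getD i false) ∘ (fun x => v.length + x) = fun i => v'.getD i false := by
      funext i
      simp only [Function.comp_apply]
      rw [List.getD_append_right _ _ _ _ (Nat.le_add_right _ _), Nat.add_sub_cancel_left]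
    rw [this]
    simp [Function.comp_def, Nat.add_assoc]

/-- The suffix gadget of a run of ones. [folklore] -/
theorem notsV_replicate_true (n₀ a : ℕ) :
    notsV n₀ (List.replicate a true) = (List.range a).map fun i => ClOp.not (n₀ + i) := by
  simp only [notsV, List.length_replicate]
  congr 1
  refine List.filter_eq_self.2 fun i hi => ?_
  rw [List.mem_range] at hi
  rw [List.getD_eq_getElem?_getD, List.getElem?_replicate_of_lt hi]
  rfl

/-- The suffix gadget of a run of zeros is empty. [folklore] -/
theorem notsV_replicate_false (n₀ a : ℕ) : notsV n₀ (List.replicate a false) = [] := by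
  simp only [notsV, List.length_replicate, List.map_eq_nil_iff]
  refine List.filter_eq_nil_iff.2 fun i hi => ?_
  rw [List.mem_range] at hi
  rw [List.getD_eq_getElem?_getD, List.getElem?_replicate_of_lt hi]
  decide

/-- The suffix gadget of a single zero is empty. [folklore] -/
theorem notsV_singleton_false (n₀ : ℕ) : notsV n₀ [false] = [] := notsV_replicate_false n₀ 1

end RevClean

end Literature.Computability.QuantumComplexity
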